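import Summits.QuantumFields.YangMills.Theorems.BalabanUVNodesN15FullPropagatorMatrixEntry2Rows
import Summits.QuantumFields.YangMills.Theorems.BalabanUVNodesN15BackgroundMatrixByPartsNode
import Summits.QuantumFields.YangMills.Theorems.BalabanUVNodesN15FullPropagatorByPartsNode
import HarnessLib

/-!
# ★★★ `T4EtaRate.NE2PlusOperator` BY NAME FOR BAŁABAN's FULL `U ≡ 1` LANDAU-GAUGE PROPAGATOR ⊗ 1_𝔤 DRESSED BY A LIVE NON-ABELIAN (MATRIX-COEFFICIENT) FIRST-ORDER
# BACKGROUND — all four (3.42) entries CONSTRUCTED, entry 2 BY PARTS, NO mixed piece; §3 modulo the `U ≡ 1` entry-2 η-defect, §4 HYPOTHESIS-FREE (dag-n15-c g9, FILE 16;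
# Track-A node N15 = NE2, s1 «background-layer OPERATOR ingredient»)

`--kind proof --supports stmt-QuantumFields-20544 --as helper` (K3⁷; count-neutral).  Imports BY NAME this seat's FILE 15 `…N15FullPropagatorMatrixEntry2Rows` (the §1 bridges
`pull_liftEquiv_eq_tensorId` ∕ `comp_fgradAdj_liftEquiv` ∕ `fgrad_liftEquiv_comp` ∕ `idef_comp_fgradAdj_liftEquiv`, ★★ `hasMaj_shiftDefect_fullGM`; through it M4 `tensorId` ∕
`hasMaj_tensorId` ∕ `idef_tensorId`), FILE 14 `…N15BackgroundMatrixByPartsNode` (`ne2PlusOperator_byParts_matrix`; through it FILE 13 `coeffBgMBP` ∕ `bgInstanceMBP` ∕ `bgFamilyMBP` ∕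
`bpRowLetters_of_reg335M` ∕ `reg335_coeffBgM₁_of_MBP`, FILE 12 `hasMaj_mmulOp_translate` ∕ `hasMaj_mmulOp_sub_translate` ∕ `pull_comp_mmulOp_translate'`, M2 `avgM₁` ∕
`rowLetters_of_reg335M`) and FILE 8 `…N15FullPropagatorByPartsNode` (`fgD`, `le_rate`, ★★ `uniform_layer_fullG`; through it dag-n15-a part 71 `hasMaj_twoGridDefect_div`, FILE 4
`symbOp_sTinv_sub_one_eq`, part 26 `blkFine_comp_kingPrV`); nothing in the tree is modified.

WHAT.  The located (ii-b) of HANDOFF §g8: the TORUS INSTANCE of FILE 14's matrix by-parts node theorem at `tensorId ι gOp` — Bałaban's full `U ≡ 1` propagator acting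
componentwise on `𝔤 ≅ ℝ^ι`-valued 1-forms ([B6] (2.156)), dressed by the first-order species `V̂ = M_C + Σ_μ M_{A_μ}∇_μ` with FIBREWISE-MATRIX coefficient fields (Bałaban's (3.52)
`V′₁(A)` in coordinates, forward orientation), coarse partner = entrywise block averages.  §1 `fgInstanceM`, `fgFamilyM` (FILE 13's `bgInstanceMBP` ∕ `bgFamilyMBP` over the
unit-torus carrier with King's pairing at `G = gOp ⊗ 1`, `D_μ = (∇_μG) ⊗ 1`, `D₃ = (ΔG) ⊗ 1`), `tensorId_fgD_eq` (the derived pieces ARE the lifted forward quotients of the lifted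
piece — FILE 12's identification hypothesis `hD`).  §2 ★★ `uniform_layer_fullGM`: the thirteen UNIFORM `U ≡ 1` letters of FILE 14 at this family, ALL tree theorems — twelve are
FILE 8's `uniform_layer_fullG` letters tensored with `1_ι`, the thirteenth is FILE 15 ★★ fed with FILE 12's translated-coefficient letters on the row letters of `coeffBgMBP`.  §3 ★★★
`ne2PlusOperator_fullGM_byParts_of_entry2` (modulo the scalar `U ≡ 1` entry-2 η-defect), §4 ★★★ **`ne2PlusOperator_fullGM_byParts`** — HYPOTHESIS-FREE with part 71 (`γ = 1∕(8(d+1))`,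
`d ≥ 1`), `_dim4`.

HONEST FRAMING ∕ LIMITS.  `T4EtaRate.NE2PlusOperator` BY NAME, NO DISPLAYED BINDER, for the GENUINE `U ≡ 1` propagator `gOp ⊗ 1_𝔤` on the torus family of record and a LIVE
non-abelian first-order background whose matrix coefficient fields are FREE data admitted by FILE 13's (3.35)–(3.36)-shaped entrywise letters (MODEL species: coefficients not
derived from a gauge field through `Phi1(η, ad A)`; forward orientation only; entrywise-linearised (C3) transport); the (3.44) mixed letter is NOT used.  NE2⁺ as printed NOT
PRINTED, NOT proved, not claimed; count-neutral (typed 28∕28 · discharged 5∕27 of record unchanged); N15 NOT discharged; one finite T⁴ at fixed ε — NOT ℝ⁴, NOT infinite volume,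
NOT OS, NOT a mass gap, NOT Clay.
-/

noncomputable section

open scoped BigOperators
open Finset

namespace Summit.QuantumFields.YangMills.BalabanUVNodes.N15.BackgroundLayer

open Literature.MathematicalPhysics.QuantumFieldTheory.Balaban1983to89
open Literature.MathematicalPhysics.QuantumFieldTheory.Balaban1983to89.B11SectG (BlockNorm HasMaj RowSum)
open Literature.MathematicalPhysics.QuantumFieldTheory.Balaban1983to89.T4EtaRate (PairedInstance NE2PlusOperator rateFactor)
open Literature.MathematicalPhysics.QuantumFieldTheory.Balaban1983to89.T4EtaRateDefect (idef idef_apply rateWeight)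
open Literature.MathematicalPhysics.QuantumFieldTheory.Balaban1983to89.T4EtaRateCoeffDefect (pull pull_apply diagK diagK_nonneg)
open Literature.MathematicalPhysics.QuantumFieldTheory.Balaban1983to89.B5Prop11Plancherel (Tor fine unitVec)
open Literature.MathematicalPhysics.QuantumFieldTheory.Balaban1983to89.B5SiteBridgeP12 (MP)
open Literature.MathematicalPhysics.QuantumFieldTheory.Balaban1983to89.B6UnitTorusCarrier (unitTorusGeo triangle254_unitTorusGeo rowSum_unitTorusGeo unitTorusGeo_dist_nonneg
  unitTorusGeo_len)
open Literature.MathematicalPhysics.QuantumFieldTheory.King1986.Torus (blockOf tdistT tdistT_nonneg tdistT_self)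
open Summit.QuantumFields.YangMills.BalabanUVNodes.N15.MatrixSpecies (mmulOp liftMap liftBlk liftEquiv)
open Summit.QuantumFields.YangMills.BalabanUVNodes.N15.TwoGrid (gOp symbOp sT sTinv sD sLap paramsOf hasMaj_rate_mono hasMaj_twoGridDefect_div TGIndex TGIndex.Mn)
open Summit.QuantumFields.YangMills.BalabanUVNodes.N15.VectorPiece (blkFine kingPrV blkFine_comp_kingPrV bshiftEquiv tensorId hasMaj_tensorId idef_tensorId)

variable {d : ℕ} {L : ℕ} [NeZero L]

/-! ## §1 The realised matrix by-parts family at Bałaban's full `U ≡ 1` propagator ⊗ 1_𝔤 on the torus family of record -/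

section Family

variable (d) (ι : Type) [Fintype ι] [DecidableEq ι]

/-- THE REALISED PAIRED INSTANCE at an index `(i, ν)` of the torus family of record and a rate exponent `γ`, colour components `ι`: FILE 13's `bgInstanceMBP` over the unit-torus
carrier (`M_μ = 2L^{m_T}`, spacings `L^{−k}` ∕ `L^{−m−k}`, King's pairing, translations `bshiftEquiv`, rate number `θ = (L^k)^{−γ}`), arguments = `𝔤 ≅ ℝ^ι`-valued 1-forms.
[cite: Balaban1985BackgroundPropagators, Thm 3.14 pp.426–427 (typing template); Balaban1984PropagatorsII, (2.156) p.250 (the `U ≡ 1` propagator on `𝔤`-valued forms: shape)] -/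
def fgInstanceM (hL : Odd L ∧ 1 < L) (γ : ℝ) (i : TGIndex × Fin (d + 1)) : PairedInstance :=
  bgInstanceMBP (Fin (d + 1)) ι (g := unitTorusGeo L i.1.k (TGIndex.Mn d hL i.1)) (blkFine L i.1.k (TGIndex.Mn d hL i.1)) (kingPrV L i.1.k i.1.m (TGIndex.Mn d hL i.1))
    (fun μ => bshiftEquiv (TGIndex.Mn d hL i.1) (L ^ i.1.k) μ) (fun μ => bshiftEquiv (TGIndex.Mn d hL i.1) (L ^ i.1.m * L ^ i.1.k) μ) ((L ^ i.1.k : ℕ) : ℝ)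
    ((L ^ i.1.m * L ^ i.1.k : ℕ) : ℝ) i.1.m (Nat.cast_ne_zero.mpr (NeZero.ne L)) (((L : ℝ) ^ i.1.k) ^ (-γ)) (((L : ℝ) ^ i.1.k) ^ (-γ))

/-- THE REALISED MATRIX BY-PARTS KERNEL FAMILY at `(i, ν)`: FILE 13's `bgFamilyMBP` with `G = gOp ⊗ 1_ι` (Bałaban's full Landau-gauge `U ≡ 1` propagator acting componentwise on
`𝔤`-valued 1-forms), `D_μ = (∇_μG) ⊗ 1_ι`, `D₃ = (ΔG) ⊗ 1_ι` at both spacings — all four (3.42) entries CONSTRUCTED, entry 2 BY PARTS, matrix coefficient species.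
[cite: Balaban1985BackgroundPropagators, (3.42) p.397 + (3.52) p.400 (shapes)] -/
def fgFamilyM (hL : Odd L ∧ 1 < L) (b γ : ℝ) (i : TGIndex × Fin (d + 1)) : B9.KernelFamily (fgInstanceM d ι hL γ i).gc (fgInstanceM d ι hL γ i).Bf :=
  bgFamilyMBP (J := Fin (d + 1)) (ι := ι) (g := unitTorusGeo L i.1.k (TGIndex.Mn d hL i.1)) (blkFine L i.1.k (TGIndex.Mn d hL i.1))
    (kingPrV L i.1.k i.1.m (TGIndex.Mn d hL i.1)) (fun μ => bshiftEquiv (TGIndex.Mn d hL i.1) (L ^ i.1.k) μ)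
    (fun μ => bshiftEquiv (TGIndex.Mn d hL i.1) (L ^ i.1.m * L ^ i.1.k) μ) ((L ^ i.1.k : ℕ) : ℝ) ((L ^ i.1.m * L ^ i.1.k : ℕ) : ℝ) i.1.m (Nat.cast_ne_zero.mpr (NeZero.ne L))
    (((L : ℝ) ^ i.1.k) ^ (-γ)) (((L : ℝ) ^ i.1.k) ^ (-γ)) i.2
    (tensorId ι (gOp (TGIndex.Mn d hL i.1) (L ^ i.1.k) b))
    (tensorId ι (symbOp (TGIndex.Mn d hL i.1) (L ^ i.1.k) (sLap (TGIndex.Mn d hL i.1) (L ^ i.1.k) ((L ^ i.1.k : ℕ) : ℝ)) ∘ₗ gOp (TGIndex.Mn d hL i.1) (L ^ i.1.k) b))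
    (fun μ => tensorId ι (fgD d (TGIndex.Mn d hL i.1) (L ^ i.1.k) b μ))
    (tensorId ι (gOp (TGIndex.Mn d hL i.1) (L ^ i.1.m * L ^ i.1.k) b))
    (tensorId ι (symbOp (TGIndex.Mn d hL i.1) (L ^ i.1.m * L ^ i.1.k) (sLap (TGIndex.Mn d hL i.1) (L ^ i.1.m * L ^ i.1.k) ((L ^ i.1.m * L ^ i.1.k : ℕ) : ℝ)) ∘ₗ
      gOp (TGIndex.Mn d hL i.1) (L ^ i.1.m * L ^ i.1.k) b))
    (fun μ => tensorId ι (fgD d (TGIndex.Mn d hL i.1) (L ^ i.1.m * L ^ i.1.k) b μ))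

omit [Fintype ι] [DecidableEq ι] in
/-- THE DERIVED PIECES ARE THE LIFTED FORWARD QUOTIENTS OF THE LIFTED PIECE: `(∇_μG) ⊗ 1 = (∇_μ ⊗ 1)∘(G ⊗ 1)` with `∇_μ ⊗ 1 = fgrad n (liftEquiv (bshiftEquiv μ) ι)` — FILE 12's
identification hypothesis `hD` for this family (so `e0_comp_fgradAdj_eq_e2ByParts_matrix` reads the by-parts entry 2 as `E₀∘∇_ν*`). [folklore] -/
theorem tensorId_fgD_eq (M : Fin (d + 1) → ℕ) [∀ μ, NeZero (M μ)] (n : ℕ) [NeZero n] (b : ℝ) (μ : Fin (d + 1)) :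
    tensorId ι (fgD d M n b μ) = fgrad (n : ℝ) (liftEquiv (bshiftEquiv M n μ) ι) ∘ₗ tensorId ι (gOp M n b) := by
  rw [fgD, fgrad_liftEquiv_comp]

end Family

/-! ## §2 The UNIFORM `U ≡ 1` letters of the matrix by-parts family at `gOp ⊗ 1_ι` — every one a tree theorem -/

section Letters

variable (d) (ι : Type) [Fintype ι] [DecidableEq ι] [Nonempty ι]

omit [DecidableEq ι] in
/-- ★★ **THE UNIFORM `U ≡ 1` LETTERS OF THE MATRIX BY-PARTS FAMILY AT BAŁABAN's FULL PROPAGATOR ⊗ 1_𝔤**, all tree theorems: for odd `L ≥ 3`, `b > 0`, `0 < γ ≤ 1∕16`, `c₃₅ > 0`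
and any target rate `δ₂ > 0` and constant `B₂ ≥ 0`, there are `δ ∈ (0, δ₂]`, `β, m₀ ≥ B₂, c_T, m_T > 0` such that at every index `(m_T, k ≥ 1, m, ν)`, ON THE PRODUCT CARRIERS
(`𝔤 ≅ ℝ^ι`-valued 1-forms, blocks `liftBlk`): the (1.110) majorants of `G ⊗ 1, (∇_μG) ⊗ 1, (ΔG) ⊗ 1, (G ⊗ 1)∇̂_ν*` at both spacings, the η-defects of `G, ∇_μG, ΔG` tensored with
`1_ι` as `m₀·(L^k)^{−γ}·e^{−δd}`, the lifted shift costs (FILE 8 `uniform_layer_fullG` through M4 `hasMaj_tensorId` ∕ `idef_tensorId` and FILE 15 §1), and THE SHIFT-DEFECT ROW LETTER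
for every `Reg335`-regular matrix coefficient family of `coeffBgMBP` (FILE 15 ★★ at `α = γ` with FILE 12's translated-coefficient letters on the carrier's row letters:
`≤ m_T·(c₃₅Mα₀|ι|)·(L^k)^{−γ}·e^{−δd}`). [cite: Balaban1984PropagatorsI, Prop. 1.2 (1.110)–(1.111) p.35; Balaban1984PropagatorsII, (2.156) p.250; King1986, p.664 (pairing)] -/
theorem uniform_layer_fullGM (hLodd : Odd L) (hL2 : 2 ≤ L) (hL : Odd L ∧ 1 < L) {b : ℝ} (hb : 0 < b) {γ : ℝ} (hγ0 : 0 < γ) (hγ1 : γ ≤ 1 / 16) (c35 : ℝ)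
    {δ₂ B₂ : ℝ} (hδ₂ : 0 < δ₂) (hB₂ : 0 ≤ B₂) :
    ∃ δ β m₀ cT mT : ℝ, 0 < δ ∧ δ ≤ δ₂ ∧ 0 < β ∧ 0 < m₀ ∧ B₂ ≤ m₀ ∧ 0 < cT ∧ 0 < mT ∧ ∀ i : TGIndex × Fin (d + 1),
      HasMaj (BlockNorm.ofBlocks (unitTorusGeo L i.1.k (TGIndex.Mn d hL i.1)) (liftBlk (blkFine L i.1.k (TGIndex.Mn d hL i.1)) ι))
          (BlockNorm.ofBlocks (unitTorusGeo L i.1.k (TGIndex.Mn d hL i.1)) (liftBlk (blkFine L i.1.k (TGIndex.Mn d hL i.1)) ι))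
          (tensorId ι (gOp (TGIndex.Mn d hL i.1) (L ^ i.1.k) b)) (fun y y' => β * Real.exp (-(δ * (unitTorusGeo L i.1.k (TGIndex.Mn d hL i.1)).dist y y'))) ∧
      (∀ μ, HasMaj (BlockNorm.ofBlocks (unitTorusGeo L i.1.k (TGIndex.Mn d hL i.1)) (liftBlk (blkFine L i.1.k (TGIndex.Mn d hL i.1)) ι))
          (BlockNorm.ofBlocks (unitTorusGeo L i.1.k (TGIndex.Mn d hL i.1)) (liftBlk (blkFine L i.1.k (TGIndex.Mn d hL i.1)) ι))
          (tensorId ι (fgD d (TGIndex.Mn d hL i.1) (L ^ i.1.k) b μ)) (fun y y' => β * Real.exp (-(δ * (unitTorusGeo L i.1.k (TGIndex.Mn d hL i.1)).dist y y')))) ∧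
      HasMaj (BlockNorm.ofBlocks (unitTorusGeo L i.1.k (TGIndex.Mn d hL i.1)) (liftBlk (blkFine L i.1.k (TGIndex.Mn d hL i.1) ∘ kingPrV L i.1.k i.1.m (TGIndex.Mn d hL i.1)) ι))
          (BlockNorm.ofBlocks (unitTorusGeo L i.1.k (TGIndex.Mn d hL i.1)) (liftBlk (blkFine L i.1.k (TGIndex.Mn d hL i.1) ∘ kingPrV L i.1.k i.1.m (TGIndex.Mn d hL i.1)) ι))
          (tensorId ι (gOp (TGIndex.Mn d hL i.1) (L ^ i.1.m * L ^ i.1.k) b)) (fun y y' => β * Real.exp (-(δ * (unitTorusGeo L i.1.k (TGIndex.Mn d hL i.1)).dist y y'))) ∧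
      (∀ μ, HasMaj (BlockNorm.ofBlocks (unitTorusGeo L i.1.k (TGIndex.Mn d hL i.1)) (liftBlk (blkFine L i.1.k (TGIndex.Mn d hL i.1) ∘ kingPrV L i.1.k i.1.m (TGIndex.Mn d hL i.1)) ι))
          (BlockNorm.ofBlocks (unitTorusGeo L i.1.k (TGIndex.Mn d hL i.1)) (liftBlk (blkFine L i.1.k (TGIndex.Mn d hL i.1) ∘ kingPrV L i.1.k i.1.m (TGIndex.Mn d hL i.1)) ι))
          (tensorId ι (fgD d (TGIndex.Mn d hL i.1) (L ^ i.1.m * L ^ i.1.k) b μ)) (fun y y' => β * Real.exp (-(δ * (unitTorusGeo L i.1.k (TGIndex.Mn d hL i.1)).dist y y')))) ∧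
      HasMaj (BlockNorm.ofBlocks (unitTorusGeo L i.1.k (TGIndex.Mn d hL i.1)) (liftBlk (blkFine L i.1.k (TGIndex.Mn d hL i.1) ∘ kingPrV L i.1.k i.1.m (TGIndex.Mn d hL i.1)) ι))
          (BlockNorm.ofBlocks (unitTorusGeo L i.1.k (TGIndex.Mn d hL i.1)) (liftBlk (blkFine L i.1.k (TGIndex.Mn d hL i.1) ∘ kingPrV L i.1.k i.1.m (TGIndex.Mn d hL i.1)) ι))
          (tensorId ι (symbOp (TGIndex.Mn d hL i.1) (L ^ i.1.m * L ^ i.1.k) (sLap (TGIndex.Mn d hL i.1) (L ^ i.1.m * L ^ i.1.k) ((L ^ i.1.m * L ^ i.1.k : ℕ) : ℝ)) ∘ₗ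
            gOp (TGIndex.Mn d hL i.1) (L ^ i.1.m * L ^ i.1.k) b)) (fun y y' => β * Real.exp (-(δ * (unitTorusGeo L i.1.k (TGIndex.Mn d hL i.1)).dist y y'))) ∧
      HasMaj (BlockNorm.ofBlocks (unitTorusGeo L i.1.k (TGIndex.Mn d hL i.1)) (liftBlk (blkFine L i.1.k (TGIndex.Mn d hL i.1)) ι))
          (BlockNorm.ofBlocks (unitTorusGeo L i.1.k (TGIndex.Mn d hL i.1)) (liftBlk (blkFine L i.1.k (TGIndex.Mn d hL i.1) ∘ kingPrV L i.1.k i.1.m (TGIndex.Mn d hL i.1)) ι))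
          (idef (pull (liftMap (kingPrV L i.1.k i.1.m (TGIndex.Mn d hL i.1)) ι)) (pull (liftMap (kingPrV L i.1.k i.1.m (TGIndex.Mn d hL i.1)) ι))
            (tensorId ι (gOp (TGIndex.Mn d hL i.1) (L ^ i.1.m * L ^ i.1.k) b)) (tensorId ι (gOp (TGIndex.Mn d hL i.1) (L ^ i.1.k) b)))
          (fun y y' => m₀ * ((L : ℝ) ^ i.1.k) ^ (-γ) * Real.exp (-(δ * (unitTorusGeo L i.1.k (TGIndex.Mn d hL i.1)).dist y y'))) ∧
      (∀ μ, HasMaj (BlockNorm.ofBlocks (unitTorusGeo L i.1.k (TGIndex.Mn d hL i.1)) (liftBlk (blkFine L i.1.k (TGIndex.Mn d hL i.1)) ι))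
          (BlockNorm.ofBlocks (unitTorusGeo L i.1.k (TGIndex.Mn d hL i.1)) (liftBlk (blkFine L i.1.k (TGIndex.Mn d hL i.1) ∘ kingPrV L i.1.k i.1.m (TGIndex.Mn d hL i.1)) ι))
          (idef (pull (liftMap (kingPrV L i.1.k i.1.m (TGIndex.Mn d hL i.1)) ι)) (pull (liftMap (kingPrV L i.1.k i.1.m (TGIndex.Mn d hL i.1)) ι))
            (tensorId ι (fgD d (TGIndex.Mn d hL i.1) (L ^ i.1.m * L ^ i.1.k) b μ)) (tensorId ι (fgD d (TGIndex.Mn d hL i.1) (L ^ i.1.k) b μ)))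
          (fun y y' => m₀ * ((L : ℝ) ^ i.1.k) ^ (-γ) * Real.exp (-(δ * (unitTorusGeo L i.1.k (TGIndex.Mn d hL i.1)).dist y y')))) ∧
      HasMaj (BlockNorm.ofBlocks (unitTorusGeo L i.1.k (TGIndex.Mn d hL i.1)) (liftBlk (blkFine L i.1.k (TGIndex.Mn d hL i.1)) ι))
          (BlockNorm.ofBlocks (unitTorusGeo L i.1.k (TGIndex.Mn d hL i.1)) (liftBlk (blkFine L i.1.k (TGIndex.Mn d hL i.1) ∘ kingPrV L i.1.k i.1.m (TGIndex.Mn d hL i.1)) ι))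
          (idef (pull (liftMap (kingPrV L i.1.k i.1.m (TGIndex.Mn d hL i.1)) ι)) (pull (liftMap (kingPrV L i.1.k i.1.m (TGIndex.Mn d hL i.1)) ι))
            (tensorId ι (symbOp (TGIndex.Mn d hL i.1) (L ^ i.1.m * L ^ i.1.k) (sLap (TGIndex.Mn d hL i.1) (L ^ i.1.m * L ^ i.1.k) ((L ^ i.1.m * L ^ i.1.k : ℕ) : ℝ)) ∘ₗ
              gOp (TGIndex.Mn d hL i.1) (L ^ i.1.m * L ^ i.1.k) b))
            (tensorId ι (symbOp (TGIndex.Mn d hL i.1) (L ^ i.1.k) (sLap (TGIndex.Mn d hL i.1) (L ^ i.1.k) ((L ^ i.1.k : ℕ) : ℝ)) ∘ₗ gOp (TGIndex.Mn d hL i.1) (L ^ i.1.k) b)))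
          (fun y y' => m₀ * ((L : ℝ) ^ i.1.k) ^ (-γ) * Real.exp (-(δ * (unitTorusGeo L i.1.k (TGIndex.Mn d hL i.1)).dist y y'))) ∧
      (∀ ν, HasMaj (BlockNorm.ofBlocks (unitTorusGeo L i.1.k (TGIndex.Mn d hL i.1)) (liftBlk (blkFine L i.1.k (TGIndex.Mn d hL i.1)) ι))
          (BlockNorm.ofBlocks (unitTorusGeo L i.1.k (TGIndex.Mn d hL i.1)) (liftBlk (blkFine L i.1.k (TGIndex.Mn d hL i.1)) ι))
          (tensorId ι (gOp (TGIndex.Mn d hL i.1) (L ^ i.1.k) b) ∘ₗ fgradAdj ((L ^ i.1.k : ℕ) : ℝ) (liftEquiv (bshiftEquiv (TGIndex.Mn d hL i.1) (L ^ i.1.k) ν) ι))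
          (fun y y' => β * Real.exp (-(δ * (unitTorusGeo L i.1.k (TGIndex.Mn d hL i.1)).dist y y')))) ∧
      (∀ ν, HasMaj (BlockNorm.ofBlocks (unitTorusGeo L i.1.k (TGIndex.Mn d hL i.1)) (liftBlk (blkFine L i.1.k (TGIndex.Mn d hL i.1) ∘ kingPrV L i.1.k i.1.m (TGIndex.Mn d hL i.1)) ι))
          (BlockNorm.ofBlocks (unitTorusGeo L i.1.k (TGIndex.Mn d hL i.1)) (liftBlk (blkFine L i.1.k (TGIndex.Mn d hL i.1) ∘ kingPrV L i.1.k i.1.m (TGIndex.Mn d hL i.1)) ι))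
          (tensorId ι (gOp (TGIndex.Mn d hL i.1) (L ^ i.1.m * L ^ i.1.k) b) ∘ₗ
            fgradAdj ((L ^ i.1.m * L ^ i.1.k : ℕ) : ℝ) (liftEquiv (bshiftEquiv (TGIndex.Mn d hL i.1) (L ^ i.1.m * L ^ i.1.k) ν) ι))
          (fun y y' => β * Real.exp (-(δ * (unitTorusGeo L i.1.k (TGIndex.Mn d hL i.1)).dist y y')))) ∧
      (∀ μ, HasMaj (BlockNorm.ofBlocks (unitTorusGeo L i.1.k (TGIndex.Mn d hL i.1)) (liftBlk (blkFine L i.1.k (TGIndex.Mn d hL i.1)) ι))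
          (BlockNorm.ofBlocks (unitTorusGeo L i.1.k (TGIndex.Mn d hL i.1)) (liftBlk (blkFine L i.1.k (TGIndex.Mn d hL i.1)) ι))
          (pull ⇑(liftEquiv (bshiftEquiv (TGIndex.Mn d hL i.1) (L ^ i.1.k) μ) ι)) (fun y y' => cT * Real.exp (-(δ * (unitTorusGeo L i.1.k (TGIndex.Mn d hL i.1)).dist y y')))) ∧
      (∀ μ, HasMaj (BlockNorm.ofBlocks (unitTorusGeo L i.1.k (TGIndex.Mn d hL i.1)) (liftBlk (blkFine L i.1.k (TGIndex.Mn d hL i.1) ∘ kingPrV L i.1.k i.1.m (TGIndex.Mn d hL i.1)) ι))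
          (BlockNorm.ofBlocks (unitTorusGeo L i.1.k (TGIndex.Mn d hL i.1)) (liftBlk (blkFine L i.1.k (TGIndex.Mn d hL i.1) ∘ kingPrV L i.1.k i.1.m (TGIndex.Mn d hL i.1)) ι))
          (pull ⇑(liftEquiv (bshiftEquiv (TGIndex.Mn d hL i.1) (L ^ i.1.m * L ^ i.1.k) μ) ι))
          (fun y y' => cT * Real.exp (-(δ * (unitTorusGeo L i.1.k (TGIndex.Mn d hL i.1)).dist y y')))) ∧
      (∀ (U : (Tor (fine (L ^ i.1.m * L ^ i.1.k) (TGIndex.Mn d hL i.1)) × Fin (d + 1) → Matrix ι ι ℝ) ×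
            (Fin (d + 1) → Tor (fine (L ^ i.1.m * L ^ i.1.k) (TGIndex.Mn d hL i.1)) × Fin (d + 1) → Matrix ι ι ℝ)) (α₀ : ℝ),
          (coeffBgMBP (Fin (d + 1)) ι (kingPrV L i.1.k i.1.m (TGIndex.Mn d hL i.1)) (fun μ => bshiftEquiv (TGIndex.Mn d hL i.1) (L ^ i.1.k) μ)
            (fun μ => bshiftEquiv (TGIndex.Mn d hL i.1) (L ^ i.1.m * L ^ i.1.k) μ) ((L ^ i.1.k : ℕ) : ℝ) ((L ^ i.1.m * L ^ i.1.k : ℕ) : ℝ)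
            (unitTorusGeo L i.1.k (TGIndex.Mn d hL i.1)).M (((L : ℝ) ^ i.1.k) ^ (-γ))).Reg335 c35 α₀ U →
        ∀ μ, HasMaj (BlockNorm.ofBlocks (unitTorusGeo L i.1.k (TGIndex.Mn d hL i.1)) (liftBlk (liftBlk (blkFine L i.1.k (TGIndex.Mn d hL i.1)) ι) (Fin (d + 1))))
          (BlockNorm.ofBlocks (unitTorusGeo L i.1.k (TGIndex.Mn d hL i.1)) (liftBlk (blkFine L i.1.k (TGIndex.Mn d hL i.1) ∘ kingPrV L i.1.k i.1.m (TGIndex.Mn d hL i.1)) ι))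
          (idef (pull (liftMap (kingPrV L i.1.k i.1.m (TGIndex.Mn d hL i.1)) ι)) (pull (liftMap (kingPrV L i.1.k i.1.m (TGIndex.Mn d hL i.1)) ι))
              (pull ⇑(liftEquiv (bshiftEquiv (TGIndex.Mn d hL i.1) (L ^ i.1.m * L ^ i.1.k) μ) ι)) (pull ⇑(liftEquiv (bshiftEquiv (TGIndex.Mn d hL i.1) (L ^ i.1.k) μ) ι)) ∘ₗ
            (mmulOp ((avgM₁ (Fin (d + 1)) ι (kingPrV L i.1.k i.1.m (TGIndex.Mn d hL i.1)) U).2 μ ∘ ⇑(bshiftEquiv (TGIndex.Mn d hL i.1) (L ^ i.1.k) μ).symm) ∘ₗ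
              sumJ fun ν => tensorId ι (gOp (TGIndex.Mn d hL i.1) (L ^ i.1.k) b) ∘ₗ
                fgradAdj ((L ^ i.1.k : ℕ) : ℝ) (liftEquiv (bshiftEquiv (TGIndex.Mn d hL i.1) (L ^ i.1.k) ν) ι)))
          (fun y y' => mT * (c35 * (unitTorusGeo L i.1.k (TGIndex.Mn d hL i.1)).M * α₀ * Fintype.card ι) * ((L : ℝ) ^ i.1.k) ^ (-γ) *
            Real.exp (-(δ * (unitTorusGeo L i.1.k (TGIndex.Mn d hL i.1)).dist y y')))) := by
  have hL0 : 0 < L := by omega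
  have hLr : (0 : ℝ) ≤ (L : ℝ) := Nat.cast_nonneg _
  have hLr1 : (1 : ℝ) ≤ (L : ℝ) := by exact_mod_cast (show 1 ≤ L by omega)
  have hγlt1 : γ < 1 := by linarith
  obtain ⟨δ₄, C₄, hδ₄, hC₄, H4⟩ := hasMaj_shiftDefect_fullGM (d := d) ι hLodd hL2 hb hγ0.le hγlt1
  obtain ⟨δ, β, m₀, cT, _mT₀, hδ, hδδ, hβ, hm₀, hBm, hcT, -, H⟩ := uniform_layer_fullG d hLodd hL2 hL hb hγ0 hγ1 c35 (lt_min hδ₂ hδ₄) hB₂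
  have hδ₂' : δ ≤ δ₂ := hδδ.trans (min_le_left _ _)
  have hδ₄' : δ ≤ δ₄ := hδδ.trans (min_le_right _ _)
  refine ⟨δ, β, m₀, cT, 2 * C₄, hδ, hδ₂', hβ, hm₀, hBm, hcT, by positivity, fun i => ?_⟩
  obtain ⟨hG, hD, hG', hD', hD₃', hDG, hDD, hDD₃, hS, hS', hSh, hSh', -⟩ := H i
  obtain ⟨⟨mT, k, hk, m⟩, ν⟩ := i
  simp only at hG hD hG' hD' hD₃' hDG hDD hDD₃ hS hS' hSh hSh' ⊢
  have hx1 : (1 : ℝ) ≤ (L : ℝ) ^ k := one_le_pow₀ hLr1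
  have hxθ : 0 ≤ ((L : ℝ) ^ k) ^ (-γ) := Real.rpow_nonneg (by positivity) _
  have hcast : ((L ^ k : ℕ) : ℝ) = (L : ℝ) ^ k := by push_cast; ring
  have hd0 : ∀ y y' : Tor (TGIndex.Mn d hL ⟨mT, k, hk, m⟩), 0 ≤ tdistT (TGIndex.Mn d hL ⟨mT, k, hk, m⟩) y y' := fun y y' => tdistT_nonneg _ _ _
  have hβK : ∀ y y' : Tor (TGIndex.Mn d hL ⟨mT, k, hk, m⟩), 0 ≤ β * Real.exp (-(δ * tdistT (TGIndex.Mn d hL ⟨mT, k, hk, m⟩) y y')) :=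
    fun _ _ => mul_nonneg hβ.le (Real.exp_nonneg _)
  have hmK : ∀ y y' : Tor (TGIndex.Mn d hL ⟨mT, k, hk, m⟩), 0 ≤ m₀ * ((L : ℝ) ^ k) ^ (-γ) * Real.exp (-(δ * tdistT (TGIndex.Mn d hL ⟨mT, k, hk, m⟩) y y')) :=
    fun _ _ => mul_nonneg (mul_nonneg hm₀.le hxθ) (Real.exp_nonneg _)
  have hcK : ∀ y y' : Tor (TGIndex.Mn d hL ⟨mT, k, hk, m⟩), 0 ≤ cT * Real.exp (-(δ * tdistT (TGIndex.Mn d hL ⟨mT, k, hk, m⟩) y y')) :=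
    fun _ _ => mul_nonneg hcT.le (Real.exp_nonneg _)
  refine ⟨hasMaj_tensorId ι hβK hG, fun μ => hasMaj_tensorId ι hβK (hD μ), hasMaj_tensorId ι hβK hG', fun μ => hasMaj_tensorId ι hβK (hD' μ), hasMaj_tensorId ι hβK hD₃',
    ?_, fun μ => ?_, ?_, fun ν' => ?_, fun ν' => ?_, fun μ => ?_, fun μ => ?_, fun U α₀ hreg μ => ?_⟩
  · rw [idef_tensorId]; exact hasMaj_tensorId ι hmK hDG
  · rw [idef_tensorId]; exact hasMaj_tensorId ι hmK (hDD μ)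
  · rw [idef_tensorId]; exact hasMaj_tensorId ι hmK hDD₃
  · rw [comp_fgradAdj_liftEquiv]; exact hasMaj_tensorId ι hβK (hS ν')
  · rw [comp_fgradAdj_liftEquiv]; exact hasMaj_tensorId ι hβK (hS' ν')
  · rw [pull_liftEquiv_eq_tensorId]; exact hasMaj_tensorId ι hcK (hSh μ)
  · rw [pull_liftEquiv_eq_tensorId]; exact hasMaj_tensorId ι hcK (hSh' μ)
  · -- the shift-defect row letter: FILE 15 ★★ at `C_a := M_{Ā_μ∘e_μ⁻¹}`, `C_a⁺ := M_{Ā_μ}`, FILE 12's letters on the carrier's row letters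
    have hreg' := hreg
    obtain ⟨⟨⟨hsc, -⟩, -⟩, -⟩ := hreg'
    obtain ⟨i₀⟩ := (inferInstance : Nonempty ι)
    have hr0 : 0 ≤ c35 * (unitTorusGeo L k (TGIndex.Mn d hL ⟨mT, k, hk, m⟩)).M * α₀ := (abs_nonneg _).trans (hsc 0 i₀ i₀)
    obtain ⟨-, ha, -, -, -, -⟩ := rowLetters_of_reg335M (J := Fin (d + 1)) (ι := ι) (kingPrV L k m (TGIndex.Mn d hL ⟨mT, k, hk, m⟩)) hr0
      (reg335_coeffBgM₁_of_MBP (Fin (d + 1)) ι hreg)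
    obtain ⟨-, -, -, -, hosc⟩ := bpRowLetters_of_reg335M (kingPrV L k m (TGIndex.Mn d hL ⟨mT, k, hk, m⟩)) hreg
    set r : ℝ := c35 * (unitTorusGeo L k (TGIndex.Mn d hL ⟨mT, k, hk, m⟩)).M * α₀ * Fintype.card ι with hrdef
    have hr : 0 ≤ r := mul_nonneg hr0 (Nat.cast_nonneg _)
    have hrθ : 0 ≤ r * ((L : ℝ) ^ k) ^ (-γ) := mul_nonneg hr hxθ
    have hCa := hasMaj_mmulOp_translate (g := unitTorusGeo L k (TGIndex.Mn d hL ⟨mT, k, hk, m⟩)) (blkFine L k (TGIndex.Mn d hL ⟨mT, k, hk, m⟩))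
      (τ := fun μ => bshiftEquiv (TGIndex.Mn d hL ⟨mT, k, hk, m⟩) (L ^ k) μ) hr ha μ
    have hOsc := hasMaj_mmulOp_sub_translate (g := unitTorusGeo L k (TGIndex.Mn d hL ⟨mT, k, hk, m⟩)) (blkFine L k (TGIndex.Mn d hL ⟨mT, k, hk, m⟩))
      (τ := fun μ => bshiftEquiv (TGIndex.Mn d hL ⟨mT, k, hk, m⟩) (L ^ k) μ) (A := (avgM₁ (Fin (d + 1)) ι (kingPrV L k m (TGIndex.Mn d hL ⟨mT, k, hk, m⟩)) U).2) μ hrθ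
      (hosc μ)
    have hCaS := pull_comp_mmulOp_translate' (τ := fun μ => bshiftEquiv (TGIndex.Mn d hL ⟨mT, k, hk, m⟩) (L ^ k) μ)
      (A := (avgM₁ (Fin (d + 1)) ι (kingPrV L k m (TGIndex.Mn d hL ⟨mT, k, hk, m⟩)) U).2) μ
    have key := H4 mT k m hk hL μ _ _ r (r * ((L : ℝ) ^ k) ^ (-γ)) hr hrθ hCaS hCa hOsc
    refine key.mono fun y y' => ?_
    rw [hcast]
    have hE : Real.exp (-(δ₄ * tdistT (TGIndex.Mn d hL ⟨mT, k, hk, m⟩) y y')) ≤ Real.exp (-(δ * tdistT (TGIndex.Mn d hL ⟨mT, k, hk, m⟩) y y')) :=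
      Real.exp_le_exp.mpr (by nlinarith [hd0 y y'])
    have heq : C₄ * (r * ((L : ℝ) ^ k) ^ (-γ) + r * ((L : ℝ) ^ k) ^ (-γ)) = 2 * C₄ * r * ((L : ℝ) ^ k) ^ (-γ) := by ring
    calc C₄ * (r * ((L : ℝ) ^ k) ^ (-γ) + r * ((L : ℝ) ^ k) ^ (-γ)) * Real.exp (-(δ₄ * tdistT (TGIndex.Mn d hL ⟨mT, k, hk, m⟩) y y'))
        ≤ C₄ * (r * ((L : ℝ) ^ k) ^ (-γ) + r * ((L : ℝ) ^ k) ^ (-γ)) * Real.exp (-(δ * tdistT (TGIndex.Mn d hL ⟨mT, k, hk, m⟩) y y')) :=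
          mul_le_mul_of_nonneg_left hE (by positivity)
      _ = 2 * C₄ * r * ((L : ℝ) ^ k) ^ (-γ) * Real.exp (-(δ * tdistT (TGIndex.Mn d hL ⟨mT, k, hk, m⟩) y y')) := by rw [heq]

end Letters

/-! ## §3 ★★★ `NE2PlusOperator` BY NAME for `gOp ⊗ 1_𝔤` dressed by a LIVE matrix-coefficient first-order background, modulo the `U ≡ 1` entry-2 η-defect -/

section Node

variable (d) (ι : Type) [Fintype ι] [DecidableEq ι] [Nonempty ι]

/-- ★★★ **`T4EtaRate.NE2PlusOperator` BY NAME FOR BAŁABAN's FULL `U ≡ 1` PROPAGATOR ⊗ 1_𝔤 DRESSED BY A LIVE NON-ABELIAN (MATRIX-COEFFICIENT) FIRST-ORDER BACKGROUND, MODULO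
ONLY THE `U ≡ 1` ENTRY-2 η-DEFECT.**  On the torus family of record (odd `L ≥ 3`, `b > 0`, `c₃₅ > 0`, `0 < γ ≤ 1∕16`, colour components `ι` nonempty): IF the η-defect of the scalar
`U ≡ 1` entry 2 obeys `𝔇(G′∇′_ν*, G∇_ν*) ≤ B₂·(L^k)^{−γ}·e^{−δ₂|y−y′|_T}` uniformly, THEN `NE2PlusOperator c₃₅ (fgInstanceM d ι hL γ) (fgFamilyM d ι hL b γ)` — FILE 14
`ne2PlusOperator_byParts_matrix` at the realised family, every other `U ≡ 1` input a tree theorem (§2). [cite: Balaban1985BackgroundPropagators, Thm 3.1 p.397 (quantifier template); (3.35)–(3.36) p.396, (3.42) p.397, (3.52) p.400, (3.63)–(3.65) p.402 (shapes, mechanism); Balaban1984PropagatorsI, Prop. 1.2 (1.110)–(1.111) p.35; Balaban1984PropagatorsII, (2.156) p.250] -/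
theorem ne2PlusOperator_fullGM_byParts_of_entry2 (hLodd : Odd L) (hL2 : 2 ≤ L) (hL : Odd L ∧ 1 < L) {b : ℝ} (hb : 0 < b) (c35 : ℝ) (hc35 : 0 < c35)
    {γ : ℝ} (hγ0 : 0 < γ) (hγ1 : γ ≤ 1 / 16) {B₂ δ₂ : ℝ} (hB₂ : 0 ≤ B₂) (hδ₂ : 0 < δ₂)
    (h2 : ∀ (i : TGIndex) (ν : Fin (d + 1)),
      HasMaj (BlockNorm.ofBlocks (unitTorusGeo L i.k (TGIndex.Mn d hL i)) (blkFine L i.k (TGIndex.Mn d hL i)))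
        (BlockNorm.ofBlocks (unitTorusGeo L i.k (TGIndex.Mn d hL i)) (blkFine L i.k (TGIndex.Mn d hL i) ∘ kingPrV L i.k i.m (TGIndex.Mn d hL i)))
        (idef (pull (kingPrV L i.k i.m (TGIndex.Mn d hL i))) (pull (kingPrV L i.k i.m (TGIndex.Mn d hL i)))
          (gOp (TGIndex.Mn d hL i) (L ^ i.m * L ^ i.k) b ∘ₗ fgradAdj ((L ^ i.m * L ^ i.k : ℕ) : ℝ) (bshiftEquiv (TGIndex.Mn d hL i) (L ^ i.m * L ^ i.k) ν))
          (gOp (TGIndex.Mn d hL i) (L ^ i.k) b ∘ₗ fgradAdj ((L ^ i.k : ℕ) : ℝ) (bshiftEquiv (TGIndex.Mn d hL i) (L ^ i.k) ν)))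
        (fun y y' => B₂ * ((L : ℝ) ^ i.k) ^ (-γ) * Real.exp (-(δ₂ * tdistT (TGIndex.Mn d hL i) y y')))) :
    NE2PlusOperator c35 (fgInstanceM d ι hL γ) (fgFamilyM d ι hL b γ) := by
  obtain ⟨δ, β, m₀, cT, mT, hδ, hδδ₂, hβ, hm₀, hBm, hcT, hmT, H⟩ := uniform_layer_fullGM d ι hLodd hL2 hL hb hγ0 hγ1 c35 hδ₂ hB₂
  have hL0 : L ≠ 0 := by omega
  have hLr : (0 : ℝ) < (L : ℝ) := by exact_mod_cast (show 0 < L by omega)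
  have hLr1 : (1 : ℝ) ≤ (L : ℝ) := by exact_mod_cast (show 1 ≤ L by omega)
  have hσ : 0 < δ / 12 := by positivity
  -- the displayed scalar entry-2 defect, rescaled to the common constants and tensored with `1_ι`
  have hDS : ∀ (i : TGIndex × Fin (d + 1)) (ν : Fin (d + 1)),
      HasMaj (BlockNorm.ofBlocks (unitTorusGeo L i.1.k (TGIndex.Mn d hL i.1)) (liftBlk (blkFine L i.1.k (TGIndex.Mn d hL i.1)) ι))
        (BlockNorm.ofBlocks (unitTorusGeo L i.1.k (TGIndex.Mn d hL i.1)) (liftBlk (blkFine L i.1.k (TGIndex.Mn d hL i.1) ∘ kingPrV L i.1.k i.1.m (TGIndex.Mn d hL i.1)) ι))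
        (idef (pull (liftMap (kingPrV L i.1.k i.1.m (TGIndex.Mn d hL i.1)) ι)) (pull (liftMap (kingPrV L i.1.k i.1.m (TGIndex.Mn d hL i.1)) ι))
          (tensorId ι (gOp (TGIndex.Mn d hL i.1) (L ^ i.1.m * L ^ i.1.k) b) ∘ₗ
            fgradAdj ((L ^ i.1.m * L ^ i.1.k : ℕ) : ℝ) (liftEquiv (bshiftEquiv (TGIndex.Mn d hL i.1) (L ^ i.1.m * L ^ i.1.k) ν) ι))
          (tensorId ι (gOp (TGIndex.Mn d hL i.1) (L ^ i.1.k) b) ∘ₗ fgradAdj ((L ^ i.1.k : ℕ) : ℝ) (liftEquiv (bshiftEquiv (TGIndex.Mn d hL i.1) (L ^ i.1.k) ν) ι)))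
        (fun y y' => m₀ * ((L : ℝ) ^ i.1.k) ^ (-γ) * Real.exp (-(δ * (unitTorusGeo L i.1.k (TGIndex.Mn d hL i.1)).dist y y'))) := fun i ν => by
    rw [idef_comp_fgradAdj_liftEquiv]
    exact hasMaj_tensorId ι (fun _ _ => mul_nonneg (mul_nonneg hm₀.le (Real.rpow_nonneg (pow_nonneg hLr.le _) _)) (Real.exp_nonneg _))
      ((h2 i.1 ν).mono fun y y' => le_rate hB₂ hBm (one_le_pow₀ hLr1) le_rfl hδδ₂ (tdistT_nonneg _ _ _))
  exact ne2PlusOperator_byParts_matrix (I := TGIndex × Fin (d + 1)) (J := Fin (d + 1)) (ι := ι) (fun i => unitTorusGeo L i.1.k (TGIndex.Mn d hL i.1))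
    (fun i => Tor (fine (L ^ i.1.k) (TGIndex.Mn d hL i.1)) × Fin (d + 1)) (fun i => Tor (fine (L ^ i.1.m * L ^ i.1.k) (TGIndex.Mn d hL i.1)) × Fin (d + 1))
    (fun i => blkFine L i.1.k (TGIndex.Mn d hL i.1)) (fun i => kingPrV L i.1.k i.1.m (TGIndex.Mn d hL i.1))
    (fun i μ => bshiftEquiv (TGIndex.Mn d hL i.1) (L ^ i.1.k) μ) (fun i μ => bshiftEquiv (TGIndex.Mn d hL i.1) (L ^ i.1.m * L ^ i.1.k) μ)
    (fun i => ((L ^ i.1.k : ℕ) : ℝ)) (fun i => ((L ^ i.1.m * L ^ i.1.k : ℕ) : ℝ)) (fun i => i.1.m) (fun _ => Nat.cast_ne_zero.mpr hL0)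
    (fun i => ((L : ℝ) ^ i.1.k) ^ (-γ)) (fun i => ((L : ℝ) ^ i.1.k) ^ (-γ)) (fun i => i.2)
    (fun i => tensorId ι (gOp (TGIndex.Mn d hL i.1) (L ^ i.1.k) b))
    (fun i => tensorId ι (symbOp (TGIndex.Mn d hL i.1) (L ^ i.1.k) (sLap (TGIndex.Mn d hL i.1) (L ^ i.1.k) ((L ^ i.1.k : ℕ) : ℝ)) ∘ₗ gOp (TGIndex.Mn d hL i.1) (L ^ i.1.k) b))
    (fun i μ => tensorId ι (fgD d (TGIndex.Mn d hL i.1) (L ^ i.1.k) b μ))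
    (fun i => tensorId ι (gOp (TGIndex.Mn d hL i.1) (L ^ i.1.m * L ^ i.1.k) b))
    (fun i => tensorId ι (symbOp (TGIndex.Mn d hL i.1) (L ^ i.1.m * L ^ i.1.k) (sLap (TGIndex.Mn d hL i.1) (L ^ i.1.m * L ^ i.1.k) ((L ^ i.1.m * L ^ i.1.k : ℕ) : ℝ)) ∘ₗ
      gOp (TGIndex.Mn d hL i.1) (L ^ i.1.m * L ^ i.1.k) b))
    (fun i μ => tensorId ι (fgD d (TGIndex.Mn d hL i.1) (L ^ i.1.m * L ^ i.1.k) b μ))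
    c35 hc35 (fun i => triangle254_unitTorusGeo L i.1.k (TGIndex.Mn d hL i.1)) (fun i a c => tdistT_nonneg _ _ _) (fun i y => tdistT_self _ y) hσ.le
    (B4Sect5Proof.latticeConst_nonneg (d + 1) hσ.le) (fun i => rowSum_unitTorusGeo L i.1.k (TGIndex.Mn d hL i.1) hσ)
    (fun i => inv_pos.mpr (pow_pos hLr _)) (fun i => hLr) (fun i y => (unitTorusGeo_len L i.1.k (TGIndex.Mn d hL i.1) hL0 y).symm.le)
    (by linarith) hβ.le hm₀.le hγ0 (fun i => Real.rpow_nonneg (pow_nonneg hLr.le _) _) (fun i y => le_rfl) hcT.le hmT.le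
    (fun i => (H i).1) (fun i => (H i).2.1) (fun i => (H i).2.2.1) (fun i => (H i).2.2.2.1) (fun i => (H i).2.2.2.2.1) (fun i => (H i).2.2.2.2.2.1)
    (fun i => (H i).2.2.2.2.2.2.1) (fun i => (H i).2.2.2.2.2.2.2.1) (fun i => (H i).2.2.2.2.2.2.2.2.1) (fun i => (H i).2.2.2.2.2.2.2.2.2.1)
    (fun i ν => hDS i ν) (fun i => (H i).2.2.2.2.2.2.2.2.2.2.1) (fun i => (H i).2.2.2.2.2.2.2.2.2.2.2.1) (fun i => (H i).2.2.2.2.2.2.2.2.2.2.2.2)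

end Node

/-! ## §4 ★★★ HYPOTHESIS-FREE: the `U ≡ 1` entry-2 η-defect IS a tree theorem (dag-n15-a part 71 `hasMaj_twoGridDefect_div`, exponent `1∕(8(d+1))`) -/

section Free

variable (d) (ι : Type) [Fintype ι] [DecidableEq ι] [Nonempty ι]

/-- ★★★ **`T4EtaRate.NE2PlusOperator` BY NAME, NO DISPLAYED BINDER: Bałaban's FULL `U ≡ 1` Landau-gauge propagator `G = Δ_b⁻¹` ACTING COMPONENTWISE ON `𝔤 ≅ ℝ^ι`-VALUED 1-FORMS
(`G ⊗ 1_𝔤`, [B6] (2.156)) on the torus family of record, dressed by a LIVE NON-ABELIAN first-order background `V̂ = M_C + Σ_μ M_{A_μ}∇_μ` with FIBREWISE-MATRIX coefficient fields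
(Bałaban's (3.52) `V′₁(A)` in coordinates, forward orientation; FILE 13's carrier `coeffBgMBP`, the (3.35)–(3.36)-shaped letters consumed on every entry of every coefficient),
ALL FOUR (3.42) entries CONSTRUCTED (entry 2 by parts = `E₀∘∇_ν*` by FILE 12's identification, `tensorId_fgD_eq`), rate exponent `γ = 1∕(8(d+1))` (`d ≥ 1`)** — §3's theorem fed
with dag-n15-a's ENTRY 2 (part 71, bridged by FILE 4 `symbOp_sTinv_sub_one_eq`).  Every input is a tree theorem.  MODEL-LEVEL in the background species (free matrix coefficient
fields, entrywise-linearised transport), GENUINE in the propagator; the (3.44) mixed letter is not used. [cite: Balaban1985BackgroundPropagators, Thm 3.1 p.397 (quantifier template); (3.35)–(3.36) p.396, (3.42) p.397, (3.52) p.400, (3.63)–(3.65) p.402 (shapes, mechanism); Balaban1984PropagatorsI, Prop. 1.2 (1.110)–(1.111) p.35; Balaban1984PropagatorsII, (2.156) p.250] -/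
theorem ne2PlusOperator_fullGM_byParts (hd1 : 1 ≤ d) (hLodd : Odd L) (hL2 : 2 ≤ L) (hL : Odd L ∧ 1 < L) {b : ℝ} (hb : 0 < b) (c35 : ℝ) (hc35 : 0 < c35) :
    NE2PlusOperator c35 (fgInstanceM d ι hL (1 / (8 * ((d : ℝ) + 1)))) (fgFamilyM d ι hL b (1 / (8 * ((d : ℝ) + 1)))) := by
  obtain ⟨δ₂, B₂, hδ₂, hB₂, H2⟩ := hasMaj_twoGridDefect_div (d := d) hLodd hL2 hb
  have hd1' : (1 : ℝ) ≤ (d : ℝ) := by exact_mod_cast hd1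
  have hγ0 : 0 < 1 / (8 * ((d : ℝ) + 1)) := by positivity
  have hγ1 : 1 / (8 * ((d : ℝ) + 1)) ≤ 1 / 16 := one_div_le_one_div_of_le (by norm_num) (by nlinarith)
  refine ne2PlusOperator_fullGM_byParts_of_entry2 d ι hLodd hL2 hL hb c35 hc35 hγ0 hγ1 hB₂.le hδ₂ fun i ν => ?_
  have h := H2 i.mT i.k i.m i.one_le hL ν
  rw [← symbOp_sTinv_sub_one_eq, ← symbOp_sTinv_sub_one_eq, blkFine_comp_kingPrV]
  refine h.mono fun y y' => le_of_eq ?_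
  rw [show ((L ^ i.k : ℕ) : ℝ) = (L : ℝ) ^ i.k by push_cast; ring]
  exact rfl

/-- The four-dimensional instance (`d + 1 = 4`, `γ = 1∕32`; e.g. `ι = Fin 3` for `𝔤 = su(2)`, `ι = Fin 8` for `su(3)`). [cite: Balaban1985BackgroundPropagators, Thm 3.1 p.397 (quantifier template)] -/
theorem ne2PlusOperator_fullGM_byParts_dim4 (hLodd : Odd L) (hL2 : 2 ≤ L) (hL : Odd L ∧ 1 < L) {b : ℝ} (hb : 0 < b) (c35 : ℝ) (hc35 : 0 < c35) :
    NE2PlusOperator c35 (fgInstanceM 3 ι hL (1 / (8 * ((3 : ℕ) : ℝ) + 8))) (fgFamilyM 3 ι hL b (1 / (8 * ((3 : ℕ) : ℝ) + 8))) := by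
  have h := ne2PlusOperator_fullGM_byParts 3 ι (by norm_num) hLodd hL2 hL hb c35 hc35
  rw [show (8 : ℝ) * ((3 : ℕ) : ℝ) + 8 = 8 * (((3 : ℕ) : ℝ) + 1) by ring]
  exact h

end Free

end Summit.QuantumFields.YangMills.BalabanUVNodes.N15.BackgroundLayer

end
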